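import Summits.BirchSwinnertonDyer.Rank1Residual.X4.OldPairOfNewVanishing
import HarnessLib

/-!
# The `ℓ`-old decomposition and its eigen components FROM TWO-COPY IHARA SURJECTIVITY AT ONE MAXIMAL IDEAL (hypothesis form; `ℓ ∣ M` allowed) (cell `b2b-bsdres`, seat additive-p4, line V48)

HONEST FRAMING (verbatim, cell `b2b-bsdres`): the goal of the cell is to DELETE the COMBINATION-SHAPED
residual classes for ALL analytic-rank `≤ 1` curves over `ℚ` — "full BSD formula for every rank `≤ 1`
curve in class `C`" assembled STRICTLY from published theorems — so that the rank-`≤ 1` remainder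
becomes exactly the CONSTRUCTION-SHAPED classes, which are TYPED (missing-input Props), NOT attempted;
this is not "finishing BSD". This file: TOOL theorems, 0 defs, 0 facts, nothing booked; X4
CONSTRUCTION-SHAPED. It serves the NL residue of TAM-DEFECT₂ (rows whose defect prime `ℓ` is
ADDITIVE, `ℓ² ∥ N`, so `ℓ ∣ M = N/ℓ`), where Ihara's lemma `ribet1984_iharaLemma` (binder `ℓ ∤ M`)
does not apply.

## What is proved

The two V45/V46 kernel theorems that consume Ihara's lemma BY NAME —
`exists_eigenPair_of_oldPair_of_ribet1984_iharaLemma` (Fitting projection) and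
`exists_oldPair_of_apply_eq_zero_of_ribet1984_iharaLemma` ((NV) ⟹ (OLD)) — use it at EXACTLY ONE
maximal ideal: the kernel `𝔫 = ker χ` of the character `χ = θ̄ : 𝕋̃ → 𝔽_p` of the row
(`𝔫 ∋ p`, `𝔫 ∋ T_r − θ(r)` for `r ∤ Mℓ`). Here they are re-proved with the TWO-COPY SURJECTIVITY
"some `s ∉ 𝔫` multiplies `H₁(X₀(M), ℤ)²` into `im(α_*, β_*)`" as a HYPOTHESIS at that ideal only
(`hS`), with NO binder `ℓ ∤ M`:

* `exists_eigenPair_of_oldPair_of_surj`: `Φ` additive and `χ`-eigen on `H₁(X₀(Mℓ), ℤ)` with an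
  `ℓ`-old decomposition `Φ = Λ₁∘α_* + Λ₂∘β_*` (additive components), `s ∉ ker χ` with the two-copy
  surjectivity ⟹ a decomposition with `χ`-EIGEN additive components (same Fitting projection along
  `ρ(s)` as gen 26, `exists_rangePow_pair` / `apply_T_smul_of_rangePow_pair`);
* `exists_oldPair_of_apply_eq_zero_of_surjAt`: `Φ` additive, `T_r`-eigen with integer eigenvalues
  `θ(r)` and VANISHING on `ker α_* ∩ ker β_*` on `H₁(X₀(Mℓ), ℤ)`, one numeral prime
  `q₀ ≡ 1 (mod Mℓ)` with `θ(q₀) ≢ q₀ + 1`, and `hS` for every maximal `𝔫 ∋ p` containing all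
  `T_r − θ(r)` and not Eisenstein ⟹ `Φ = Λ₁∘α_* + Λ₂∘β_*` on `H₁(X₀(Mℓ), ℤ)` with additive `Λ₁, Λ₂`
  on `H₁(X₀(M), ℤ)` (gen 27's extension `Λ₁(x) = χ(s)⁻¹Φ(z(s x, 0))`, fibre constancy).

WHY THE HYPOTHESIS IS THE RIGHT ONE FOR `ℓ ∣ M` (provenance, not asserted here): for `ℓ ∥ M`,
`M = M′ℓ`, the image of `(α_*, β_*)` lies in `K = ker(β′_* pr₁ − α′_* pr₂)` and the three-level
Ihara lemma (Wiles 1995 Lemma 2.5 / Darmon–Diamond–Taylor Lemma 4.28 (b), 4.30) says `K/im` is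
Eisenstein-or-away-from-`𝔫`; when moreover `𝔫` is NOT in the support of `H₁(X₀(M′), ℤ)` — the case
of a residual representation RAMIFIED at `ℓ` (Carayol: the prime-to-`p` conductor of `ρ̄` divides
the level) — `H₁(X₀(M), ℤ)²/K ↪ H₁(X₀(M′), ℤ)` has no `𝔫`-part either, and the two-copy map is
surjective at `𝔫`, exactly as for `ℓ ∤ M` (Diamond–Ribet 1997, proof of Lemma 4.6, case `m_p = 1`,
`p ≠ ℓ`: "using also that `𝔪′` is not in the support of `H₁(X₀(N_Σ/p), ℤ_ℓ)`"). The additive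
defect primes of the NL residue (`p = 3`, Kodaira IV/IV*, `c_ℓ = 3`) are of this kind.

## References

* K. A. Ribet, Proc. ICM 1983 (1984), Thm. 4.1. [cite: Ribet1984ICM, Thm. 4.1]
* H. Darmon, F. Diamond, R. Taylor, *Fermat's Last Theorem* (1995), Lemma 4.28, Lemma 4.30, §4.5
  pp. 135–137. [cite: DarmonDiamondTaylor1995, Lemma 4.28 (a), Lemma 4.30 (b), §4.5 pp. 135–137]
* F. Diamond, K. Ribet, *ℓ-adic modular deformations and Wiles's "Main Conjecture"*, in Cornell–
  Silverman–Stevens (1997), §4.4 Lemma 4.6. [cite: DiamondRibet1997, §4.4 Lemma 4.6]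
* F. Diamond, J. Shurman, *A First Course in Modular Forms* (2005), Prop. 5.6.2. [cite: DiamondShurman2005, Prop. 5.6.2]
-/

noncomputable section

open scoped MatrixGroups ModularForm

open CongruenceSubgroup Finset Matrix

open Literature.NumberTheory.EllipticCurves Literature.NumberTheory.EllipticCurves.ModularForms
  Literature.NumberTheory.EllipticCurves.ModularForms.HidaCohomology

namespace Summit.BirchSwinnertonDyer.Rank1Residual.LevelLowering

/-! ### §1 Eigen components from two-copy surjectivity at `ker χ` (Fitting projection) -/

section Fitting

variable {k : Type*} [Field k] {M : ℕ} [NeZero M] {ℓ : ℕ} [Fact ℓ.Prime]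

/-- **Annihilator form of the two-copy surjectivity at one ideal.** If `s` multiplies
`H₁(X₀(M), ℤ)²` into the image of `(α_*, β_*)`, then every pair `(Λ₁, Λ₂)` (`Λᵢ(0) = 0`) with
`Λ₁∘α_* + Λ₂∘β_* = 0` on `H₁(X₀(Mℓ), ℤ)` has `Λ₁(s x) = Λ₂(s x) = 0` on cycles (the dual of "the
cokernel is killed by `s`"; cf. `exists_forall_apply_smul_eq_zero_of_ribet1984_iharaLemma`).
[cite: Ribet1984ICM, Thm. 4.1] [cite: DiamondRibet1997, §4.4 Lemma 4.6] -/
theorem forall_apply_smul_eq_zero_of_surj {K : Type*} [CommRing K] {s : HeckeRing0 M 2}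
    (hsur : ∀ x ∈ periodHomology M, ∀ y ∈ periodHomology M, ∃ z ∈ periodHomology (M * ℓ),
      (degeneracyMap0 M (M * ℓ) 1 2).dualMap z = s • x ∧
      (degeneracyMap0 M (M * ℓ) ℓ 2).dualMap z = s • y)
    (Λ₁ Λ₂ : Module.Dual ℂ (CuspForm (Gamma0 M) 2) → K) (h₁ : Λ₁ 0 = 0) (h₂ : Λ₂ 0 = 0)
    (hker : ∀ z ∈ periodHomology (M * ℓ),
      Λ₁ ((degeneracyMap0 M (M * ℓ) 1 2).dualMap z) +
        Λ₂ ((degeneracyMap0 M (M * ℓ) ℓ 2).dualMap z) = 0)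
    {x : Module.Dual ℂ (CuspForm (Gamma0 M) 2)} (hx : x ∈ periodHomology M) :
    Λ₁ (s • x) = 0 ∧ Λ₂ (s • x) = 0 := by
  refine ⟨?_, ?_⟩
  · obtain ⟨z, hz, hα, hβ⟩ := hsur x hx 0 (zero_mem _)
    have h := hker z hz
    rwa [hα, hβ, smul_zero, h₂, add_zero] at h
  · obtain ⟨z, hz, hα, hβ⟩ := hsur 0 (zero_mem _) x hx
    have h := hker z hz
    rwa [hα, hβ, smul_zero, h₁, zero_add] at h

/-- **EIGEN COMPONENTS OF AN `ℓ`-OLD DECOMPOSITION FROM TWO-COPY SURJECTIVITY AT `ker χ`** (any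
prime `ℓ`, `ℓ ∣ M` allowed). Over a field `k`; `χ : 𝕋̃ = ℤ[T_r : r ∤ Mℓ] → k` (level-`M` operators)
with maximal kernel; `Φ` additive and `χ`-eigen (for the `T_r` of level `Mℓ`, `r ∤ Mℓ`) on
`H₁(X₀(Mℓ), ℤ)`; `s ∈ 𝕋̃ ∖ ker χ` multiplying `H₁(X₀(M), ℤ)²` into `im(α_*, β_*)`; an `ℓ`-old
decomposition with additive components ⟹ one with `χ`-EIGEN additive components (Fitting
decomposition of `V = Hom(H₁(X₀(M), ℤ), k)` along `ρ(s)`, `exists_rangePow_pair`,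
`apply_T_smul_of_rangePow_pair`). [cite: Ribet1984ICM, Thm. 4.1] [cite: DiamondRibet1997, §4.4 Lemma 4.6] -/
theorem exists_eigenPair_of_oldPair_of_surj (Φ : Module.Dual ℂ (CuspForm (Gamma0 (M * ℓ)) 2) → k)
    (Λ₁ Λ₂ : Module.Dual ℂ (CuspForm (Gamma0 M) 2) → k) (χ : HeckeRing0.primeTo M 2 (M * ℓ) →+* k)
    (hadd₁ : ∀ x ∈ periodHomology M, ∀ y ∈ periodHomology M, Λ₁ (x + y) = Λ₁ x + Λ₁ y)
    (hadd₂ : ∀ x ∈ periodHomology M, ∀ y ∈ periodHomology M, Λ₂ (x + y) = Λ₂ x + Λ₂ y)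
    (haddΦ : ∀ x ∈ periodHomology (M * ℓ), ∀ y ∈ periodHomology (M * ℓ), Φ (x + y) = Φ x + Φ y)
    (hΦT : ∀ (r : ℕ) (hr : r.Prime) (hrS : ¬ r ∣ M * ℓ), ∀ z ∈ periodHomology (M * ℓ),
      Φ (HeckeRing0.T (M * ℓ) 2 r hr • z) = χ (HeckeRing0.primeTo.T M 2 (M * ℓ) hr hrS) * Φ z)
    (h𝔫 : (RingHom.ker χ).IsMaximal) {s : HeckeRing0.primeTo M 2 (M * ℓ)} (hs : s ∉ RingHom.ker χ)
    (hsur : ∀ x ∈ periodHomology M, ∀ y ∈ periodHomology M, ∃ z ∈ periodHomology (M * ℓ),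
      (degeneracyMap0 M (M * ℓ) 1 2).dualMap z = (s : HeckeRing0 M 2) • x ∧
      (degeneracyMap0 M (M * ℓ) ℓ 2).dualMap z = (s : HeckeRing0 M 2) • y)
    (hΦ : ∀ z ∈ periodHomology (M * ℓ),
      Φ z = Λ₁ ((degeneracyMap0 M (M * ℓ) 1 2).dualMap z) +
        Λ₂ ((degeneracyMap0 M (M * ℓ) ℓ 2).dualMap z)) :
    ∃ Λ₁' Λ₂' : Module.Dual ℂ (CuspForm (Gamma0 M) 2) → k,
      (∀ x ∈ periodHomology M, ∀ y ∈ periodHomology M, Λ₁' (x + y) = Λ₁' x + Λ₁' y) ∧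
      (∀ x ∈ periodHomology M, ∀ y ∈ periodHomology M, Λ₂' (x + y) = Λ₂' x + Λ₂' y) ∧
      (∀ (s : HeckeRing0.primeTo M 2 (M * ℓ)), ∀ x ∈ periodHomology M,
        Λ₁' ((s : HeckeRing0 M 2) • x) = χ s * Λ₁' x) ∧
      (∀ (s : HeckeRing0.primeTo M 2 (M * ℓ)), ∀ x ∈ periodHomology M,
        Λ₂' ((s : HeckeRing0 M 2) • x) = χ s * Λ₂' x) ∧
      ∀ z ∈ periodHomology (M * ℓ),
        Φ z = Λ₁' ((degeneracyMap0 M (M * ℓ) 1 2).dualMap z) +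
          Λ₂' ((degeneracyMap0 M (M * ℓ) ℓ 2).dualMap z) := by
  classical
  -- the `k`-space `V = Hom(H₁(X₀(M), ℤ), k)` and the action `ρ t Λ = Λ ∘ (t • ·)` (kept opaque)
  obtain ⟨ρ, hρ⟩ : ∃ ρ : HeckeRing0 M 2 →
      ((↥(periodHomologyHecke M) →+ k) →ₗ[k] (↥(periodHomologyHecke M) →+ k)),
      ∀ (t : HeckeRing0 M 2) (Λ : ↥(periodHomologyHecke M) →+ k) (x : ↥(periodHomologyHecke M)),
        ρ t Λ x = Λ (t • x) :=
    ⟨fun t ↦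
      { toFun := fun Λ ↦ Λ.comp (DistribSMul.toAddMonoidHom (↥(periodHomologyHecke M)) t)
        map_add' := fun Λ Λ' ↦ by ext x; rfl
        map_smul' := fun c Λ ↦ by ext x; rfl }, fun _ _ _ ↦ rfl⟩
  haveI : Module.Finite k (↥(periodHomologyHecke M) →+ k) := finite_addMonoidHom_periodHomologyHecke
  -- the annihilator form of the surjectivity and the Fitting index of `ρ s`
  have hann : ∀ (Λ₁ Λ₂ : Module.Dual ℂ (CuspForm (Gamma0 M) 2) → k), Λ₁ 0 = 0 → Λ₂ 0 = 0 →
      (∀ z ∈ periodHomology (M * ℓ),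
        Λ₁ ((degeneracyMap0 M (M * ℓ) 1 2).dualMap z) +
          Λ₂ ((degeneracyMap0 M (M * ℓ) ℓ 2).dualMap z) = 0) →
      ∀ x ∈ periodHomology M,
        Λ₁ ((s : HeckeRing0 M 2) • x) = 0 ∧ Λ₂ ((s : HeckeRing0 M 2) • x) = 0 :=
    fun L₁ L₂ h₁ h₂ hker x hx ↦ forall_apply_smul_eq_zero_of_surj hsur L₁ L₂ h₁ h₂ hker hx
  obtain ⟨n, hn, hn1⟩ :=
    ((LinearMap.eventually_isCompl_ker_pow_range_pow (ρ (s : HeckeRing0 M 2))).and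
      (Filter.eventually_ge_atTop 1)).exists
  -- the given pair as elements of `V`
  obtain ⟨L₁, hL₁⟩ : ∃ L : ↥(periodHomologyHecke M) →+ k, ∀ x : ↥(periodHomologyHecke M), L x = Λ₁ x :=
    ⟨{ toFun := fun x ↦ Λ₁ x
       map_zero' := apply_zero_of_additive Λ₁ hadd₁
       map_add' := fun x y ↦ hadd₁ x x.2 y y.2 }, fun _ ↦ rfl⟩
  obtain ⟨L₂, hL₂⟩ : ∃ L : ↥(periodHomologyHecke M) →+ k, ∀ x : ↥(periodHomologyHecke M), L x = Λ₂ x :=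
    ⟨{ toFun := fun x ↦ Λ₂ x
       map_zero' := apply_zero_of_additive Λ₂ hadd₂
       map_add' := fun x y ↦ hadd₂ x x.2 y y.2 }, fun _ ↦ rfl⟩
  have hΦL : ∀ z (hz : z ∈ periodHomology (M * ℓ)),
      Φ z = L₁ ⟨_, dualMap_degeneracyMap0_one_mem_periodHomologyHecke hz⟩ +
        L₂ ⟨_, dualMap_degeneracyMap0_self_mem_periodHomologyHecke hz⟩ := fun z hz ↦ by
    rw [hL₁, hL₂]; exact hΦ z hz
  -- step 1 and step 2 of the Fitting projection
  obtain ⟨N₁, N₂, hN₁, hN₂, hΦN⟩ := exists_rangePow_pair Φ χ haddΦ hΦT ρ hρ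
    (isUnit_map_of_not_mem_ker χ h𝔫 hs) hn L₁ L₂ hΦL
  have hgen := fun (q : ℕ) (hq : q.Prime) (hqS : ¬ q ∣ M * ℓ) ↦
    apply_T_smul_of_rangePow_pair Φ χ hΦT ρ hρ hann hn hn1 hN₁ hN₂ hΦN hq hqS
  -- assemble, as bare functions extended by `0` off the lattice
  obtain ⟨n₁, hn₁⟩ : ∃ f : Module.Dual ℂ (CuspForm (Gamma0 M) 2) → k,
      ∀ x (hx : x ∈ periodHomology M), f x = N₁ ⟨x, hx⟩ :=
    ⟨fun x ↦ if hx : x ∈ periodHomology M then N₁ ⟨x, hx⟩ else 0, fun x hx ↦ dif_pos hx⟩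
  obtain ⟨n₂, hn₂⟩ : ∃ f : Module.Dual ℂ (CuspForm (Gamma0 M) 2) → k,
      ∀ x (hx : x ∈ periodHomology M), f x = N₂ ⟨x, hx⟩ :=
    ⟨fun x ↦ if hx : x ∈ periodHomology M then N₂ ⟨x, hx⟩ else 0, fun x hx ↦ dif_pos hx⟩
  refine ⟨n₁, n₂, ?_, ?_, ?_, ?_, ?_⟩
  · intro x hx y hy
    rw [hn₁ x hx, hn₁ y hy, hn₁ _ (add_mem hx hy)]
    exact N₁.map_add ⟨x, hx⟩ ⟨y, hy⟩
  · intro x hx y hy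
    rw [hn₂ x hx, hn₂ y hy, hn₂ _ (add_mem hx hy)]
    exact N₂.map_add ⟨x, hx⟩ ⟨y, hy⟩
  · rintro ⟨s', hs'⟩ x hx
    rw [hn₁ x hx, hn₁ _ (HeckeRing0.smul_mem_periodHomology _ _ hx)]
    exact apply_smul_eq_mul_of_T N₁ χ (fun q hq hqS y ↦ (hgen q hq hqS y).1) s' hs' ⟨x, hx⟩
  · rintro ⟨s', hs'⟩ x hx
    rw [hn₂ x hx, hn₂ _ (HeckeRing0.smul_mem_periodHomology _ _ hx)]
    exact apply_smul_eq_mul_of_T N₂ χ (fun q hq hqS y ↦ (hgen q hq hqS y).2) s' hs' ⟨x, hx⟩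
  · intro z hz
    rw [hn₁ _ (dualMap_degeneracyMap0_one_mem_periodHomologyHecke hz),
      hn₂ _ (dualMap_degeneracyMap0_self_mem_periodHomologyHecke hz)]
    exact hΦN z hz

end Fitting

/-! ### §2 (NV) ⟹ (OLD) from two-copy surjectivity at the ideal of `θ̄` -/

section Extension

variable {M : ℕ} [NeZero M] {ℓ : ℕ} [Fact ℓ.Prime] {p : ℕ} [hp : Fact p.Prime]

/-- **THE `ℓ`-OLD DECOMPOSITION ON CYCLES FROM THE VANISHING ON THE `ℓ`-NEW CYCLES, from two-copy
surjectivity at the maximal ideal of the row** (any prime `ℓ`, `ℓ ∣ M` allowed; no Ihara by name).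
`p` prime, `θ` integer eigenvalues, `Φ : S₂(Γ₀(Mℓ))^∨ → 𝔽_p` additive and `T_r`-eigen (`r ∤ Mℓ`) on
`H₁(X₀(Mℓ), ℤ)`, VANISHING on `ker α_* ∩ ker β_* ∩ H₁(X₀(Mℓ), ℤ)`; `q₀ ≡ 1 (mod Mℓ)` prime with
`θ(q₀) ≢ q₀ + 1 (mod p)`; `hS`: for every maximal `𝔫 ⊂ 𝕋̃` containing `p` and all `T_r − θ(r)`
(`r ∤ Mℓ`) and not Eisenstein, some `s ∉ 𝔫` multiplies `H₁(X₀(M), ℤ)²` into `im(α_*, β_*)`. Then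
`Φ = Λ₁∘α_* + Λ₂∘β_*` on `H₁(X₀(Mℓ), ℤ)` with `Λ₁, Λ₂` additive on `H₁(X₀(M), ℤ)`. (Dichotomy on
`𝔫₀ = (p, T_r − θ(r))`: `1 ∈ 𝔫₀` kills `Φ`; else `θ̄ = χ` is a character, `hS` applies at `ker χ`,
and `Λ₁(x) = χ(s)⁻¹Φ(z(s x, 0))`, `Λ₂(y) = χ(s)⁻¹Φ(z(0, s y))` by fibre constancy — gen 27's proof.)
For `ℓ ∤ M`, `hS` is implied by `ribet1984_iharaLemma` (odd `p`).
[cite: Ribet1984ICM, Thm. 4.1] [cite: DiamondRibet1997, §4.4 Lemma 4.6] -/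
theorem exists_oldPair_of_apply_eq_zero_of_surjAt (θ : ℕ → ℤ)
    (Φ : Module.Dual ℂ (CuspForm (Gamma0 (M * ℓ)) 2) → ZMod p)
    (haddΦ : ∀ x ∈ periodHomology (M * ℓ), ∀ y ∈ periodHomology (M * ℓ), Φ (x + y) = Φ x + Φ y)
    (hΦT : ∀ (r : ℕ) (hr : r.Prime), ¬ r ∣ M * ℓ → ∀ z ∈ periodHomology (M * ℓ),
      Φ (HeckeRing0.T (M * ℓ) 2 r hr • z) = ((θ r : ℤ) : ZMod p) * Φ z)
    (hvan : ∀ z ∈ periodHomology (M * ℓ), (degeneracyMap0 M (M * ℓ) 1 2).dualMap z = 0 →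
      (degeneracyMap0 M (M * ℓ) ℓ 2).dualMap z = 0 → Φ z = 0)
    {q₀ : ℕ} (hq₀ : q₀.Prime) (hq₀1 : q₀ ≡ 1 [MOD M * ℓ])
    (hθq₀ : ((θ q₀ : ℤ) : ZMod p) ≠ q₀ + 1)
    (hS : ∀ 𝔫 : Ideal (HeckeRing0.primeTo M 2 (M * ℓ)), 𝔫.IsMaximal →
      (p : HeckeRing0.primeTo M 2 (M * ℓ)) ∈ 𝔫 →
      (∀ (r : ℕ) (hr : r.Prime) (hrS : ¬ r ∣ M * ℓ),
        HeckeRing0.primeTo.T M 2 (M * ℓ) hr hrS - (θ r : HeckeRing0.primeTo M 2 (M * ℓ)) ∈ 𝔫) →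
      ¬ HeckeRing0.primeTo.IsEisenstein 𝔫 →
      ∃ s : HeckeRing0.primeTo M 2 (M * ℓ), s ∉ 𝔫 ∧
        ∀ x ∈ periodHomology M, ∀ y ∈ periodHomology M, ∃ z ∈ periodHomology (M * ℓ),
          (degeneracyMap0 M (M * ℓ) 1 2).dualMap z = (s : HeckeRing0 M 2) • x ∧
          (degeneracyMap0 M (M * ℓ) ℓ 2).dualMap z = (s : HeckeRing0 M 2) • y) :
    ∃ Λ₁ Λ₂ : Module.Dual ℂ (CuspForm (Gamma0 M) 2) → ZMod p,
      (∀ x ∈ periodHomology M, ∀ y ∈ periodHomology M, Λ₁ (x + y) = Λ₁ x + Λ₁ y) ∧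
      (∀ x ∈ periodHomology M, ∀ y ∈ periodHomology M, Λ₂ (x + y) = Λ₂ x + Λ₂ y) ∧
      ∀ z ∈ periodHomology (M * ℓ),
        Φ z = Λ₁ ((degeneracyMap0 M (M * ℓ) 1 2).dualMap z) +
          Λ₂ ((degeneracyMap0 M (M * ℓ) ℓ 2).dualMap z) := by
  classical
  have hℓ : ℓ.Prime := Fact.out
  haveI : NeZero ℓ := ⟨hℓ.ne_zero⟩
  have h1d : M * 1 ∣ M * ℓ := by rw [mul_one]; exact dvd_mul_right M ℓ
  have hℓd : M * ℓ ∣ M * ℓ := dvd_rfl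
  have hq₀N : ¬ q₀ ∣ M * ℓ := by
    intro hd
    have h01 : 1 ≡ 0 [MOD q₀] :=
      ((hq₀1.of_dvd hd).symm.trans (Nat.modEq_zero_iff_dvd.mpr (dvd_refl q₀)))
    exact hq₀.one_lt.ne' (Nat.dvd_one.mp (Nat.modEq_zero_iff_dvd.mp h01))
  by_cases h1 : (1 : HeckeRing0.primeTo M 2 (M * ℓ)) ∈ Ideal.span
      ({(p : HeckeRing0.primeTo M 2 (M * ℓ))} ∪
        {x | ∃ (r : ℕ) (hr : r.Prime) (hrS : ¬ r ∣ M * ℓ),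
          x = HeckeRing0.primeTo.T M 2 (M * ℓ) hr hrS - (θ r : HeckeRing0.primeTo M 2 (M * ℓ))})
  · -- CASE 1: `1 ∈ 𝔫₀` ⟹ `Φ = 0` on cycles; `Λ₁ = Λ₂ = 0`
    have hzero := apply_eq_zero_of_one_mem_idealSpan_of_dualMap θ (ZMod.natCast_self p) Φ haddΦ
      hΦT hvan h1
    refine ⟨fun _ ↦ 0, fun _ ↦ 0, fun _ _ _ _ ↦ (add_zero _).symm, fun _ _ _ _ ↦ (add_zero _).symm,
      fun z hz ↦ ?_⟩
    rw [hzero z hz, add_zero]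
  · -- CASE 2: `θ̄` is a character `χ` of the level-`M` Hecke ring
    obtain ⟨χ, hχ⟩ := exists_ringHom_apply_T_eq_of_one_not_mem_idealSpan (p := p) θ h1
    have h𝔫 : (RingHom.ker χ).IsMaximal :=
      RingHom.ker_isMaximal_of_surjective χ (ZMod.ringHom_surjective χ)
    have hp𝔫 : (p : HeckeRing0.primeTo M 2 (M * ℓ)) ∈ RingHom.ker χ := by
      rw [RingHom.mem_ker, map_natCast, ZMod.natCast_self]
    have hT𝔫 : ∀ (r : ℕ) (hr : r.Prime) (hrS : ¬ r ∣ M * ℓ),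
        HeckeRing0.primeTo.T M 2 (M * ℓ) hr hrS - (θ r : HeckeRing0.primeTo M 2 (M * ℓ)) ∈
          RingHom.ker χ := fun r hr hrS ↦ by
      rw [RingHom.mem_ker, map_sub, hχ r hr hrS, map_intCast, sub_self]
    have hE : ¬ HeckeRing0.primeTo.IsEisenstein (RingHom.ker χ) := by
      intro hEis
      have h := hEis q₀ hq₀ hq₀N hq₀1
      rw [RingHom.mem_ker, map_sub, hχ q₀ hq₀ hq₀N, map_add, map_natCast, map_one, sub_eq_zero] at h
      exact hθq₀ h
    have hΦTχ : ∀ (r : ℕ) (hr : r.Prime) (hrS : ¬ r ∣ M * ℓ), ∀ z ∈ periodHomology (M * ℓ),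
        Φ (HeckeRing0.T (M * ℓ) 2 r hr • z) = χ (HeckeRing0.primeTo.T M 2 (M * ℓ) hr hrS) * Φ z :=
      fun r hr hrS z hz ↦ by rw [hχ r hr hrS]; exact hΦT r hr hrS z hz
    -- the element `s ∉ ker χ` of `hS` and its transport `t` to level `Mℓ`
    obtain ⟨s, hs, hsur⟩ := hS (RingHom.ker χ) h𝔫 hp𝔫 hT𝔫 hE
    have hcs : χ s ≠ 0 := fun h ↦ hs (by rwa [RingHom.mem_ker])
    obtain ⟨t, hαt, hβt, hΦt⟩ := exists_levelRaise Φ χ haddΦ hΦTχ (s : HeckeRing0 M 2) s.2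
    -- the cycles `z(x, y)` of level `Mℓ` over `(s • x, s • y)`
    choose! zf hzf hzfα hzfβ using hsur
    have h0M : (0 : Module.Dual ℂ (CuspForm (Gamma0 M) 2)) ∈ periodHomology M := zero_mem _
    -- the extension
    refine ⟨fun x ↦ (χ s)⁻¹ * Φ (zf x 0), fun y ↦ (χ s)⁻¹ * Φ (zf 0 y), fun x hx y hy ↦ ?_,
      fun x hx y hy ↦ ?_, fun z hz ↦ ?_⟩
    · -- `Λ₁` is additive: fibre constancy over `(s • (x + y), 0)`
      beta_reduce
      have hsum : zf x 0 + zf y 0 ∈ periodHomology (M * ℓ) := add_mem (hzf x hx 0 h0M) (hzf y hy 0 h0M)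
      rw [← mul_add, ← haddΦ _ (hzf x hx 0 h0M) _ (hzf y hy 0 h0M),
        apply_eq_of_dualMap_eq Φ haddΦ hvan (hzf _ (add_mem hx hy) 0 h0M) hsum
          (by rw [map_add, hzfα _ (add_mem hx hy) 0 h0M, hzfα x hx 0 h0M, hzfα y hy 0 h0M, smul_add])
          (by rw [map_add, hzfβ _ (add_mem hx hy) 0 h0M, hzfβ x hx 0 h0M, hzfβ y hy 0 h0M,
            smul_zero, add_zero])]
    · -- `Λ₂` is additive: fibre constancy over `(0, s • (x + y))`
      beta_reduce
      have hsum : zf 0 x + zf 0 y ∈ periodHomology (M * ℓ) := add_mem (hzf 0 h0M x hx) (hzf 0 h0M y hy)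
      rw [← mul_add, ← haddΦ _ (hzf 0 h0M x hx) _ (hzf 0 h0M y hy),
        apply_eq_of_dualMap_eq Φ haddΦ hvan (hzf 0 h0M _ (add_mem hx hy)) hsum
          (by rw [map_add, hzfα 0 h0M _ (add_mem hx hy), hzfα 0 h0M x hx, hzfα 0 h0M y hy,
            smul_zero, add_zero])
          (by rw [map_add, hzfβ 0 h0M _ (add_mem hx hy), hzfβ 0 h0M x hx, hzfβ 0 h0M y hy, smul_add])]
    · -- the identity on cycles: `Λ₁(α_* z) + Λ₂(β_* z) = χ(s)⁻¹ Φ(t • z) = Φ(z)`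
      beta_reduce
      set x := (degeneracyMap0 M (M * ℓ) 1 2).dualMap z with hx
      set y := (degeneracyMap0 M (M * ℓ) ℓ 2).dualMap z with hy
      have hxM : x ∈ periodHomology M := dualMap_degeneracyMap0_mem_periodHomology M (M * ℓ) 1 h1d hz
      have hyM : y ∈ periodHomology M := dualMap_degeneracyMap0_mem_periodHomology M (M * ℓ) ℓ hℓd hz
      have hsum : zf x 0 + zf 0 y ∈ periodHomology (M * ℓ) := add_mem (hzf x hxM 0 h0M) (hzf 0 h0M y hyM)
      have htz : t • z ∈ periodHomology (M * ℓ) := HeckeRing0.smul_mem_periodHomology _ t hz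
      have hw : Φ (zf x 0 + zf 0 y) = Φ (t • z) :=
        apply_eq_of_dualMap_eq Φ haddΦ hvan hsum htz
          (by rw [map_add, hzfα x hxM 0 h0M, hzfα 0 h0M y hyM, smul_zero, add_zero, hαt z])
          (by rw [map_add, hzfβ x hxM 0 h0M, hzfβ 0 h0M y hyM, smul_zero, zero_add, hβt z])
      rw [← mul_add, ← haddΦ _ (hzf x hxM 0 h0M) _ (hzf 0 h0M y hyM), hw, hΦt z hz, ← mul_assoc,
        Subtype.coe_eta, inv_mul_cancel₀ hcs, one_mul]

/-- **`ribet1984_iharaLemma` supplies `hS` for `ℓ ∤ M` and odd `p`** (so the hypothesis form is a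
GENERALISATION of gen 27's theorem, not a different statement): at every maximal `𝔫 ∋ p` that is not
Eisenstein, Ihara's lemma gives the two-copy surjectivity (`2 ∉ 𝔫` because `p ∈ 𝔫`, `p ≠ 2`, `𝔫`
proper). [cite: Ribet1984ICM, Thm. 4.1] [cite: DarmonDiamondTaylor1995, Lemma 4.28 (a), Lemma 4.30 (b), §4.5 pp. 135–137] -/
theorem surjAt_of_ribet1984_iharaLemma (hI : ribet1984_iharaLemma) (hℓM : ¬ ℓ ∣ M) (hp2 : p ≠ 2)
    (θ : ℕ → ℤ) :
    ∀ 𝔫 : Ideal (HeckeRing0.primeTo M 2 (M * ℓ)), 𝔫.IsMaximal →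
      (p : HeckeRing0.primeTo M 2 (M * ℓ)) ∈ 𝔫 →
      (∀ (r : ℕ) (hr : r.Prime) (hrS : ¬ r ∣ M * ℓ),
        HeckeRing0.primeTo.T M 2 (M * ℓ) hr hrS - (θ r : HeckeRing0.primeTo M 2 (M * ℓ)) ∈ 𝔫) →
      ¬ HeckeRing0.primeTo.IsEisenstein 𝔫 →
      ∃ s : HeckeRing0.primeTo M 2 (M * ℓ), s ∉ 𝔫 ∧
        ∀ x ∈ periodHomology M, ∀ y ∈ periodHomology M, ∃ z ∈ periodHomology (M * ℓ),
          (degeneracyMap0 M (M * ℓ) 1 2).dualMap z = (s : HeckeRing0 M 2) • x ∧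
          (degeneracyMap0 M (M * ℓ) ℓ 2).dualMap z = (s : HeckeRing0 M 2) • y := by
  intro 𝔫 h𝔫 hp𝔫 _ hE
  refine hI M ℓ hℓM 𝔫 h𝔫 (fun h2 ↦ ?_) hE
  -- `2 ∈ 𝔫` and `p ∈ 𝔫` with `p` odd would put `1 = gcd(2, p) ∈ 𝔫`
  have hcop : Nat.Coprime 2 p := (Nat.coprime_primes Nat.prime_two hp.out).mpr (Ne.symm hp2)
  have h1 : (1 : HeckeRing0.primeTo M 2 (M * ℓ)) ∈ 𝔫 := by
    obtain ⟨a, b, hab⟩ : ∃ a b : ℤ, a * 2 + b * p = 1 := by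
      have := Nat.Coprime.isCoprime hcop
      obtain ⟨a, b, h⟩ := (Nat.isCoprime_iff_coprime.mpr hcop)
      exact ⟨a, b, by simpa using h⟩
    have e : (1 : HeckeRing0.primeTo M 2 (M * ℓ)) =
        (a : HeckeRing0.primeTo M 2 (M * ℓ)) * 2 + (b : HeckeRing0.primeTo M 2 (M * ℓ)) * p := by
      have := congrArg (fun z : ℤ ↦ (z : HeckeRing0.primeTo M 2 (M * ℓ))) hab
      push_cast at this
      exact this.symm
    rw [e]
    exact 𝔫.add_mem (𝔫.mul_mem_left _ h2) (𝔫.mul_mem_left _ hp𝔫)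
  exact h𝔫.ne_top ((Ideal.eq_top_iff_one 𝔫).mpr h1)

end Extension

end Summit.BirchSwinnertonDyer.Rank1Residual.LevelLowering

end
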